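import Mathlib

/-!
# Solo-blind seat (MatrixMultiplication), s71 — relation planes in `𝔽₃⁴` contain a chain-type vector (paper/KraftK3.md §7.12, K3.12.14)

The combinatorial half of THEOREM U(4,2) ("no anisotropic quadratic system of rank 2 on `𝔽₃⁴` has a universal frame"): the values
`q_i = Q(v_i) ∈ 𝔽₃² ∖ {0}` of a frame span rank `≤ 2`, so their relation space `R ⊆ 𝔽₃⁴` has dimension `≥ 2` and contains no vector of
support one.  This file certifies (`decide +kernel`) that every such plane contains a vector of CHAIN TYPE — support `k ∈ {2, 3, 4}` with
`⌊k/2⌋` coefficients of the minority sign, i.e. (up to sign and order) `q_a = q_b`, `q_a + q_c = q_b` or `q_a + q_c = q_b + q_d` — the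
relations realised by the rhombus, the 3-chain and the 4-chain networks (Chain Lemma, K3.12.11/14; cf. `SoloBlindLineIdentity`).
Pure finite combinatorics; no `ω` content.
-/

set_option linter.dupNamespace false
set_option autoImplicit false

namespace Summit.MatrixMultiplication.MatrixMultiplication.Theorems

/-- Number of nonzero coordinates of `v : 𝔽₃⁴`. -/
def suppCard4 (v : Fin 4 → ZMod 3) : ℕ := (Finset.univ.filter fun i => v i ≠ 0).card

/-- Number of coordinates of `v : 𝔽₃⁴` equal to `2 = -1`. -/
def negCard4 (v : Fin 4 → ZMod 3) : ℕ := (Finset.univ.filter fun i => v i = 2).card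

/-- `v` has CHAIN TYPE: (support, minority-sign count) ∈ {(2,1), (3,1), (4,2)} — the sign patterns of alternating sums along chains of
2, 3, 4 axis lines. -/
abbrev IsChainType4 (v : Fin 4 → ZMod 3) : Prop :=
  (suppCard4 v = 2 ∧ min (negCard4 v) (suppCard4 v - negCard4 v) = 1) ∨
  (suppCard4 v = 3 ∧ min (negCard4 v) (suppCard4 v - negCard4 v) = 1) ∨
  (suppCard4 v = 4 ∧ min (negCard4 v) (suppCard4 v - negCard4 v) = 2)


/-- RELATION PLANES CONTAIN A CHAIN TYPE: if `u, w ∈ 𝔽₃⁴` span a plane (every nontrivial combination is nonzero) containing no vector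
of support one, then some nontrivial combination `a u + b w` has chain type. -/
theorem relationPlane_contains_chainType :
    ∀ u w : Fin 4 → ZMod 3,
      (∀ a b : ZMod 3, (a ≠ 0 ∨ b ≠ 0) → a • u + b • w ≠ 0 ∧ suppCard4 (a • u + b • w) ≠ 1) →
      ∃ a b : ZMod 3, (a ≠ 0 ∨ b ≠ 0) ∧ IsChainType4 (a • u + b • w) := by
  decide +kernel

end Summit.MatrixMultiplication.MatrixMultiplication.Theorems
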